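import Literature.AlgebraicGeometry.Markman2025.SecantLineChernCharacters
import HarnessLib

/-!
# Markman's secant object on a principally polarized abelian FOURFOLD ([S] §12): the CLASS computation in the
# `Θ`-subalgebra `K[Θ]/(Θ⁵)`, kernel-checked under explicit modelling inputs

E. Markman, [S] *Secant sheaves and Weil classes on abelian varieties*, arXiv:2509.23403 **v2** (2026-02-11; the §12
theta-translate EXAMPLE typed below is new in v2 — it replaces v1's one-sentence pointer to [M2, Ex. 8.2.3]/[Ex. 8.2.4];
§12 itself — heading, «We expect …» paragraph, the question — is on p. 21 in both versions), bib
`Markman2025SurveySecant` (published carrier ICM 2026 Proc., bib `Markman2026ICMSecant`; the §12 object is PREPRINT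
material, «yet to be checked» in print). «v2 p. N L m» = PyMuPDF lines of the public v2 PDF
(sha256/16 `3151aee3307548da`), read at seat lit-w-markman (pub-hsemireg LIT-W; TABLE row M-Mk10, sheet §23 (E3-d),
two seat generations + lit-1 g28). Companion of `SecantFourfoldExampleCount.lean` (the printed COUNTS) and of the
`Theta4` model of `SecantLineChernCharacters.lean` (the `Θ`-subalgebra of a p.p. abelian fourfold in the divided-power
basis `1, Θ, Θ²/2!, Θ³/3!, Θ⁴/4! = [pt]`, `exp(cΘ)`, `α_d`, `β_d` with `exp(√−dΘ) = α_d + √−d·β_d`).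

AS PRINTED, v2 p. 21 L57 – p. 22 L13: «Consider for example a principally polarized abelian fourfold `(X, Θ)`. Let `d`
be an odd integer `≥ 3`, set `K := ℚ(√−d)`, and set `n := (d + 9)/2`. Let `{D_i : i ∈ ℤ/nℤ}` be `n` generic
translates of the divisor `Θ`, cyclically indexed, such that for every subset `S ⊂ ℤ/nℤ` of cardinality `|S|` the
intersection `∩_{i∈S} D_i` is smooth of codimension `|S|`, if `2 ≤ |S| ≤ 4`, or empty if `|S| ≥ 5`. Set
`Z_i := D_i ∩ D_{i+1}`, `1 ≤ i ≤ n`, and set `Z := ∪_{i=1}^n Z_i`. Note that the intersection `Z_i ∩ Z_j` is a smooth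
curve, if `i − j = ±1` and it consists of `24` points if `i ∉ {j − 1, j, j + 1}`. Let `ν : Z̃ → Z` be the partial
normalization of `Z` along `(d+9)(2d−1)` of its `(d+9)(3d−3)` isolated points of self intersection. Then the
Chern character of the object `[𝒪_X →^{ν^*} (ν_*𝒪_{Z̃})] ⊗ 𝒪_X(Θ)` belongs to the secant `span{exp(√−dΘ),
exp(−√−dΘ)}`. It is yet to be checked if these secant objects satisfy the weaker criterion in Question 11.4.»;
footnote 7 to «isolated⁷ points» (v2 p. 22 foot): «The intersection points of `Z_i ∩ Z_j` are isolated, if and only if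
`i ∉ {j − 2, j − 1, j, j + 1, j + 2}`.» — the PRINTED support for the far-pair bookkeeping in (M2)/(M3) below
(isolated nodes come from the pairs with `j − i ∉ {0, ±1, ±2}`, `n(n−5)/2` of them, `24` points each:
`12n(n−5) = (d+9)(3d−3)`, `SecantFourfoldExampleCount.isolatedPoints_count`).

MODELLING INPUTS (the cell's, sheet §23 (E3-d); standard, but NOT statements of [S] and not proved here — they are
turned into DEFINITIONS of classes in the `Theta4` model, so every theorem below is an identity of that model):
(M1) inclusion–exclusion for the union `Z = ∪ Z_i` of the surfaces `Z_i = D_i ∩ D_{i+1}`: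
  `[𝒪_Z] = Σ_{∅≠S} (−1)^{|S|+1} [𝒪_{D_{S ∪ (S+1)}}]` in `K`-theory;
(M2) Koszul: `ch(𝒪_{D_T}) = (1 − e^{−Θ})^{|T|}` for a transversal intersection of `|T|` translates (`= 0` for `|T| ≥ 5`);
  with (M1) only five subset types survive — `S = {i}` (`|T| = 2`, `n` of them, sign `+`), `{i, i+1}` (`|T| = 3`,
  `n`, `−`), `{i, i+2}` (`|T| = 4`, `n`, `−`), far pairs `{i, j}`, `j − i ∉ {0, ±1, ±2}` (`|T| = 4`, `n(n−5)/2` of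
  them by `SecantFourfoldExampleCount.card_farPairs`, `−`), `{i, i+1, i+2}` (`|T| = 4`, `n`, `+`) — whence
  `ch(𝒪_Z) = n·u² − n·u³ − (n(n−5)/2)·u⁴`, `u := 1 − e^{−Θ}` (the two `±n·u⁴` terms cancel);
(M3) the partial normalization of `m` transversal isolated double points adds `m` skyscrapers:
  `ch(ν_*𝒪_{Z̃}) = ch(𝒪_Z) + m·[pt]`;
(M4) `Θ⁴ = 4!·[pt]` (principal polarization; built into `Theta4`).

WHAT THIS FILE PROVES (theorems; 0 named facts; nothing about any variety): `chOZ_closedForm`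
(`ch(𝒪_Z) = nΘ² − 2nΘ³ + (25n/12 − n(n−5)/2)Θ⁴`); `integral_chNuOZ` (with the printed `n = (d+9)/2` and
`m = (d+9)(2d−1)`: `ch₄(ν_*𝒪_{Z̃}) = (d+9)(27−d)[pt]`); `secant_iff_degree_two` (for ANY `n, m` and twist `kΘ`:
if `ch([𝒪_X → ν_*𝒪_{Z̃}] ⊗ 𝒪_X(kΘ)) = a·α_d + b·β_d` then `a = 1`, `b = k` and `2n = d + k²`);
`secant_membership_twist_three` (with the printed `n`, `m` and the twist `3Θ` the class IS `α_d + 3β_d`, for every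
`d` — degrees 3 and 4 check on the nose); `printed_twist_not_secant` (with the printed twist `Θ`, i.e. `k = 1`,
the class is NOT of the form `a·α_d + b·β_d` in characteristic `0`: degree 2 reads `−d − 8 ≠ −d`).  READING (the
cell's, ×0 as to intent; sheet §23 (E3-d), TABLE M-Mk10): under (M1)–(M4) the printed sentence is exactly right with
«`⊗ 𝒪_X(Θ)`» read as «`⊗ 𝒪_X(3Θ)`» — matching the bookkeeping `a₂ = d + a₃²`, `a₃ = 3` of [M] = arXiv:2502.03415v2
Example 8.2.3, visibly the source of «`n = (d+9)/2`»; this is a typo-class reading of one sentence of an unrefereed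
preprint, not a claim about semiregularity or about Question 11.4, and not a statement of [S].
-/

namespace Literature.AlgebraicGeometry.Markman2025

namespace SurveySec12

open Theta4

variable {K : Type*} [Field K]

section Defs

/-- (M2) `u := ch(𝒪_{D_i}) = 1 − e^{−Θ}` for one theta translate (Koszul), in the `Theta4` model.
[cite: Markman2025SurveySecant, §12, v2 p. 21 L61–64 (transcription; modelling input (M2) of the pub-hsemireg LIT-W Markman
sheet, section 23 (E3-d))] -/
def u : Theta4 K := 1 - exp (-1)

/-- (M1)+(M2): `ch(𝒪_Z) = n·u² − n·u³ − (n(n−5)/2)·u⁴` for the union `Z` of the `n` surfaces `Z_i = D_i ∩ D_{i+1}`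
(`n` any scalar here). [cite: Markman2025SurveySecant, §12, v2 p. 21 L61–66 (transcription; modelling inputs
(M1)(M2))] -/
def chOZ (n : K) : Theta4 K := n • (u * u) - n • (u * u * u) - (n * (n - 5) / 2) • (u * u * u * u)

/-- (M3): `ch(ν_*𝒪_{Z̃}) = ch(𝒪_Z) + m·[pt]` after normalizing `m` isolated transversal double points.
[cite: Markman2025SurveySecant, §12, v2 p. 21 L67 – p. 22 L3 (transcription; modelling input (M3))] -/
def chNuOZ (n m : K) : Theta4 K := chOZ n + m • pt

/-- The class of the printed object with a general twist: `ch([𝒪_X → ν_*𝒪_{Z̃}] ⊗ 𝒪_X(kΘ)) =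
(1 − ch(ν_*𝒪_{Z̃}))·exp(kΘ)` (the two-term complex has `𝒪_X` in degree `0`).
[cite: Markman2025SurveySecant, §12, v2 p. 22 L4–8 (transcription)] -/
def chObject (n m k : K) : Theta4 K := (1 - chNuOZ n m) * exp k

end Defs

variable [CharZero K]

/-- The powers of `u = 1 − e^{−Θ} = Θ − Θ²/2 + Θ³/6 − Θ⁴/24`: `u² = Θ² − Θ³ + (7/12)Θ⁴`, `u³ = Θ³ − (3/2)Θ⁴`,
`u⁴ = Θ⁴` (divided-power coordinates `Θ² = 2·[Θ²/2!]` etc.).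
[cite: Markman2025SurveySecant, §12, v2 p. 21 L61–64 (transcription; model arithmetic)] -/
theorem u_powers :
    (u : Theta4 K) = theta - (1 / 2 : K) • thetaSq + (1 / 6 : K) • thetaCube - (1 / 24 : K) • thetaFourth ∧
    (u * u : Theta4 K) = thetaSq - thetaCube + (7 / 12 : K) • thetaFourth ∧
    (u * u * u : Theta4 K) = thetaCube - (3 / 2 : K) • thetaFourth ∧
    (u * u * u * u : Theta4 K) = thetaFourth := by
  refine ⟨?_, ?_, ?_, ?_⟩ <;> ext <;> simp [u] <;> ring

/-- **`ch(𝒪_Z) = nΘ² − 2nΘ³ + (25n/12 − n(n−5)/2)Θ⁴`** (sheet §23 (E3-d), now kernel-checked from (M1)(M2)).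
[cite: Markman2025SurveySecant, §12, v2 p. 21 L61–66 (transcription; the cell's class computation)] -/
theorem chOZ_closedForm (n : K) :
    chOZ n = n • thetaSq - (2 * n) • thetaCube + (25 * n / 12 - n * (n - 5) / 2) • (thetaFourth : Theta4 K) := by
  ext <;> simp [chOZ, u] <;> ring

/-- **`ch₄(ν_*𝒪_{Z̃}) = (d+9)(27−d)·[pt]`** with the printed `n = (d+9)/2` and `m = (d+9)(2d−1)`
(`24·(25n/12 − n(n−5)/2) + m = 25(d+9) − 3(d+9)(d−1) + (d+9)(2d−1)`).
[cite: Markman2025SurveySecant, §12, v2 p. 21 L60 and p. 22 L3 (transcription; the cell's class computation)] -/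
theorem integral_chNuOZ (d : K) :
    integral (chNuOZ ((d + 9) / 2) ((d + 9) * (2 * d - 1)) : Theta4 K) = (d + 9) * (27 - d) := by
  simp [chNuOZ, chOZ, u, integral]
  ring

omit [CharZero K] in
/-- **Degree-two bookkeeping, for any `n`, `m` and twist `k`**: if the class of `[𝒪_X → ν_*𝒪_{Z̃}] ⊗ 𝒪_X(kΘ)`
equals `a·α_d + b·β_d`, then `a = 1` (degree 0), `b = k` (degree 2·1) and `2n = d + k²` (degree 2·2: `k² − 2n = −d`)
— so the printed `n = (d+9)/2` pins `k² = 9`. [cite: Markman2025SurveySecant, §12, v2 p. 21 L60 and p. 22 L4–12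
(transcription; the cell's class computation)] -/
theorem secant_iff_degree_two (d n m k a b : K) (h : chObject n m k = a • alpha d + b • beta d) :
    a = 1 ∧ b = k ∧ 2 * n = d + k ^ 2 := by
  have h0 := congrArg Theta4.c0 h
  have h1 := congrArg Theta4.c1 h
  have h2 := congrArg Theta4.c2 h
  simp [chObject, chNuOZ, chOZ, u, alpha, beta] at h0 h1 h2
  have ha : a = 1 := by linear_combination -h0
  subst ha
  refine ⟨rfl, by linear_combination -h1, ?_⟩
  linear_combination -h2

/-- **With the twist `3Θ` the printed class claim holds on the nose, for every `d`:**
`ch([𝒪_X → ν_*𝒪_{Z̃}] ⊗ 𝒪_X(3Θ)) = α_d + 3·β_d ∈ span{exp(√−dΘ), exp(−√−dΘ)}` for `n = (d+9)/2`,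
`m = (d+9)(2d−1)` (degrees 0–4: `1`, `3Θ`, `(9 − 2n)Θ²/2 = −dΘ²/2`, `−3d·Θ³/3!`, `d²·[pt]`).
[cite: Markman2025SurveySecant, §12, v2 p. 21 L57 – p. 22 L12 (transcription; the cell's class computation under
(M1)–(M4), LIT-W Markman sheet section 23 (E3-d))] -/
theorem secant_membership_twist_three (d : K) :
    chObject ((d + 9) / 2) ((d + 9) * (2 * d - 1)) 3 = alpha d + (3 : K) • beta d := by
  ext <;> simp [chObject, chNuOZ, chOZ, u, alpha, beta] <;> ring

/-- The same class written out against `exp(±sΘ)`, `s² = −d`: `α_d + 3β_d = ½(1 − 3s/d)·exp(sΘ) + ½(1 + 3s/d)·exp(−sΘ)`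
— membership in the `K`-span of the two pure spinors (for `d ≠ 0`).
[cite: Markman2025SurveySecant, §12, v2 p. 22 L8–12 (transcription; model arithmetic)] -/
theorem secant_membership_pure_spinors (d s : K) (hs : s ^ 2 = -d) (hd : d ≠ 0) :
    alpha d + (3 : K) • beta d =
      ((1 - 3 * s / d) / 2) • exp s + ((1 + 3 * s / d) / 2) • (exp (-s) : Theta4 K) := by
  have hs' : (-s) ^ 2 = -d := by rw [neg_sq, hs]
  rw [exp_sqrt_neg d s hs, exp_sqrt_neg d (-s) hs']
  ext <;> simp [alpha, beta] <;> (try field_simp) <;>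
    first | (linear_combination (6 : K) * hs) | (linear_combination (-6 : K) * hs) | ring

/-- **With the twist AS PRINTED (`𝒪_X(Θ)`, `k = 1`) the class is NOT on the secant line** under (M1)–(M4): degree
`2` of the class is `(1 − 2n)Θ²/2 = (−d − 8)Θ²/2`, while every `a·α_d + b·β_d` with the right degree-0 term has
`−dΘ²/2` there (`8 ≠ 0`). This is the cell's reading «`⊗ 𝒪_X(Θ)` reads `⊗ 𝒪_X(3Θ)`» (sheet §23 (E3-d)); a
typo-class remark on one preprint sentence, nothing more. [cite: Markman2025SurveySecant, §12, v2 p. 22 L4–12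
(transcription; the cell's class computation)] -/
theorem printed_twist_not_secant (d a b : K) :
    chObject ((d + 9) / 2) ((d + 9) * (2 * d - 1)) 1 ≠ a • alpha d + b • beta d := by
  intro h
  have h0 := congrArg Theta4.c0 h
  have h2 := congrArg Theta4.c2 h
  simp [chObject, chNuOZ, chOZ, u, alpha, beta] at h0 h2
  have ha : a = 1 := by linear_combination -h0
  subst ha
  have : (8 : K) = 0 := by linear_combination -h2
  norm_num at this

end SurveySec12

end Literature.AlgebraicGeometry.Markman2025
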